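import Literature.AlgebraicGeometry.Motives.AbelianVarietyFactorFrobeniusTraces
import HarnessLib

/-!
# Hecke operators on the Kani–Rosen factor `B_H`: for an `H`-bi-stable `S ⊆ G` (a union of double cosets `HgH`) the
# endomorphism `T_S = Σ_{x ∈ S} ρ(x)` restricts to `B_H = Im N_H`, and
# `Tr(T_S|_{B_H} | T_ℓ B_H) = Σ_{x ∈ S} χ_ℓ(x)`, `Tr(T_S|_{B_H} ∘ π_{B_H}^m | T_ℓ B_H) = Σ_{x ∈ S} Tr(ρ(x) π_X^m | T_ℓ X)`

Let `X` be an abelian variety over a field `K` with an action `ρ : G → End X`, `H ≤ G` a finite subgroup with norm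
`N_H = Σ_{h ∈ H} ρ(h)` and factor `B_H = Im N_H`, and `S ⊆ G` a finite subset stable under left and right multiplication by
`H` — e.g. a double coset `HgH` or a union of such; the HECKE OPERATOR of `S` is `T_S := Σ_{x ∈ S} ρ(x) ∈ End X`.  Then (§1)

  `N_H T_S = T_S N_H = |H| · T_S`                                             (`norm_mul_hecke_eq_card_nsmul`, `hecke_mul_norm_eq_card_nsmul`)

(for fixed `h ∈ H` the translations `x ↦ hx`, `x ↦ xh` permute `S`), so `T_S` commutes with `N_H` and restricts to
`T_S|_{B_H} ∈ End B_H` (the tree's `imageRestrict`, Mumford §19 Thm. 1; on `V_ℓ(B_H) ≅ V_ℓ(X)^H`, `T_S|` is `|H|` times the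
classical double-coset operator `[HgH] v = Σ_{y ∈ HgH/H} y v`).  With the prequels' trace identity
`Tr(T_ℓ(b ≫ N_H)) = |H| · Tr(T_ℓ(b|_{B_H}))` (`Motives/AbelianVarietyEquivariantFactorCharacter` §1) and `T_S ≫ N_H = |H| · T_S`:

  **`Tr(T_ℓ(T_S|_{B_H}) | T_ℓ B_H) = Σ_{x ∈ S} χ_ℓ(x)`**,   `χ_ℓ(x) = Tr(T_ℓ ρ(x) | T_ℓ X)`     (§2, any field, `ℓ` invertible in `K`)

— the trace of a Hecke operator on the `H`-invariant part is the plain sum of the `ℓ`-adic character over the double coset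
(`Tr([HgH] | V^H) = |H|⁻¹ Σ_{x ∈ HgH} χ_V(x)`; for `S = H`: `T_H = N_H` acts on `B_H` as `|H|` and the formula is the prequel's
`|H| · 2 dim B_H = Σ_{h ∈ H} χ_ℓ(h)`); and over a FINITE field, composing with powers of the Frobenius (§3, which commutes
with everything and restricts to `π_{B_H}`, `Motives/AbelianVarietyFactorFrobeniusTraces`):

  **`Tr(T_ℓ(T_S|_{B_H}) ∘ T_ℓ(π_{B_H})^m | T_ℓ B_H) = Σ_{x ∈ S} τ_m(x)`**,   `τ_m(x) = Tr(T_ℓ ρ(x) ∘ T_ℓ(π_X)^m | T_ℓ X)`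

— the Eichler–Shimura-type shape "trace of (Hecke operator × Frobenius power) on `H¹_ℓ` of the quotient = sum over the
double coset of twisted Frobenius traces upstairs" on the algebraic carrier, with no Lefschetz formula claimed.

## Main statements (sorry-free; theorems only, no new definitions)

* §1 `sum_map_mul_right_eq_of_stable`, `sum_map_mul_left_eq_of_stable` (reindexing over an `H`-stable `S`),
  **`hecke_mul_norm_eq_card_nsmul`**, **`norm_mul_hecke_eq_card_nsmul`** (`T_S N_H = N_H T_S = |H| T_S` in `End X`),
  `hecke_comp_norm_eq_norm_comp_hecke`, `hecke_comp_norm_eq_card_nsmul` (Hom forms).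
* §2 **`trace_tateModuleMap_imageRestrict_hecke_eq_sum`** (`Tr(T_ℓ(T_S|_{B_H})) = Σ_{x ∈ S} χ_ℓ(x)`).
* §3 (finite field) `imageRestrict_frobeniusHom_pow_comp`, **`trace_tateModuleMap_imageRestrict_hecke_comp_frobeniusHom_pow_eq_sum`**
  (`Tr(T_ℓ(T_S|) ∘ T_ℓ(π_{B_H})^m) = Σ_{x ∈ S} τ_m(x)`).

Scope (stated, not hidden).  `S` is any finite `H`-bi-stable subset given as a `Finset G` with the two stability hypotheses
(double cosets are not named as such; no Hecke ALGEBRA structure, no composition law `T_S T_{S'}` is formalised); `ℓ`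
invertible in `K` for the trace identities; `B_H = Im N_H`; no point counts or fixed-point formulae.

## References

* [DokchitserEtAl2022] V. Dokchitser, H. Green, A. Konstantinou, A. Morgan, *Parity of ranks of Jacobians of curves*,
  arXiv:2211.06357, §3 (additive functor lemma `F(J_X)^H ↔ F(Jac_{X/H})`, composites `|H|`; Lemma 3.7: `Hom_G(ℤ[G/H], ℤ[G/H']) ≅
  ℤ[H\G/H']`, double cosets `HgH'` acting by `Σ`), proof of Thm. 8.4.
* [KaniRosen1989] E. Kani, M. Rosen, *Idempotent relations and factors of Jacobians*, Math. Ann. 284 (1989), §3 (`ε_H`, `B_H`).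
* [MumfordAV1970] D. Mumford, *Abelian Varieties* (1970), §19 Thm. 1 (p. 173), Thm. 3 (p. 176), Thm. 4 (p. 180).
* [Milne1986AbelianVarieties] J. S. Milne, *Abelian varieties*, in Cornell–Silverman (1986), §12 Prop. 12.9; §19, proof of
  Thm. 19.1 (pp. 144–145).
* [LangeRodriguez2022] H. Lange, R. E. Rodríguez, *Decomposition of Jacobians by Prym Varieties*, LNM 2310 (2022), §2.9.1.
-/

noncomputable section

open CategoryTheory CategoryTheory.Limits
open Literature.RepresentationTheory.FiniteGroups
open Literature.NumberTheory.DiophantineGeometry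

universe u

namespace Literature.AlgebraicGeometry.Motives

namespace AbelianVariety

/-! ## §1 `T_S N_H = N_H T_S = |H| · T_S` for an `H`-bi-stable `S` -/

section Stable

variable {G : Type} [Group G] {H : Subgroup G} [Fintype H] {S : Finset G} {M : Type*} [AddCommMonoid M]

omit [Fintype H] in
/-- Reindexing over a right-`H`-stable finite set: `Σ_{x ∈ S} f(x h) = Σ_{x ∈ S} f(x)` for `h ∈ H` (`x ↦ xh` permutes `S`).
[cite: DokchitserEtAl2022, §3 Lemma 3.7 (double cosets)] -/
theorem sum_map_mul_right_eq_of_stable (hr : ∀ h : H, ∀ x ∈ S, x * (h : G) ∈ S) (f : G → M) (h : H) :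
    ∑ x ∈ S, f (x * h) = ∑ x ∈ S, f x := by
  refine Finset.sum_equiv (Equiv.mulRight (h : G)) (fun x ↦ ?_) (fun x _ ↦ rfl)
  constructor
  · exact hr h x
  · intro hx
    have := hr h⁻¹ _ hx
    rwa [Equiv.coe_mulRight, Subgroup.coe_inv, mul_inv_cancel_right] at this

omit [Fintype H] in
/-- Reindexing over a left-`H`-stable finite set: `Σ_{x ∈ S} f(h x) = Σ_{x ∈ S} f(x)` for `h ∈ H`.
[cite: DokchitserEtAl2022, §3 Lemma 3.7 (double cosets)] -/
theorem sum_map_mul_left_eq_of_stable (hl : ∀ h : H, ∀ x ∈ S, (h : G) * x ∈ S) (f : G → M) (h : H) :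
    ∑ x ∈ S, f (h * x) = ∑ x ∈ S, f x := by
  refine Finset.sum_equiv (Equiv.mulLeft (h : G)) (fun x ↦ ?_) (fun x _ ↦ rfl)
  constructor
  · exact hl h x
  · intro hx
    have := hl h⁻¹ _ hx
    rwa [Equiv.coe_mulLeft, Subgroup.coe_inv, inv_mul_cancel_left] at this

variable {K : Type u} [Field K] {X : AbelianVariety K} (ρ : G →* End X) {N T : X ⟶ X}

/-- **`T_S · N_H = |H| · T_S`** in `End X` for the Hecke operator `T_S = Σ_{x ∈ S} ρ(x)` of a right-`H`-stable `S`
(`Σ_x Σ_h ρ(xh) = Σ_h Σ_x ρ(x)`). [cite: DokchitserEtAl2022, §3 Lemma 3.6 (1) and Lemma 3.7] [cite: KaniRosen1989, §3] -/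
theorem hecke_mul_norm_eq_card_nsmul (hr : ∀ h : H, ∀ x ∈ S, x * (h : G) ∈ S) (hN : End.of N = ∑ h : H, ρ h)
    (hT : End.of T = ∑ x ∈ S, ρ x) : End.of T * End.of N = Fintype.card H • End.of T := by
  rw [hT, hN, Finset.sum_mul_sum, Finset.sum_comm]
  simp_rw [← map_mul]
  rw [Finset.sum_congr rfl fun h _ ↦ sum_map_mul_right_eq_of_stable hr (fun x ↦ ρ x) h, Finset.sum_const, Finset.card_univ]

/-- **`N_H · T_S = |H| · T_S`** in `End X` for a left-`H`-stable `S`. [cite: DokchitserEtAl2022, §3 Lemma 3.6 (1) and Lemma 3.7] [cite: KaniRosen1989, §3] -/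
theorem norm_mul_hecke_eq_card_nsmul (hl : ∀ h : H, ∀ x ∈ S, (h : G) * x ∈ S) (hN : End.of N = ∑ h : H, ρ h)
    (hT : End.of T = ∑ x ∈ S, ρ x) : End.of N * End.of T = Fintype.card H • End.of T := by
  rw [hT, hN, Finset.sum_mul_sum]
  simp_rw [← map_mul]
  rw [Finset.sum_congr rfl fun h _ ↦ sum_map_mul_left_eq_of_stable hl (fun x ↦ ρ x) h, Finset.sum_const, Finset.card_univ]

/-- **`T_S` commutes with `N_H`** (as morphisms: `T_S ≫ N_H = N_H ≫ T_S`) for an `H`-bi-stable `S`, so `T_S` restricts to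
`B_H = Im N_H`. [cite: DokchitserEtAl2022, §3 Lemma 3.7] [cite: MumfordAV1970, §19 Thm. 1 (p. 173)] -/
theorem hecke_comp_norm_eq_norm_comp_hecke (hl : ∀ h : H, ∀ x ∈ S, (h : G) * x ∈ S) (hr : ∀ h : H, ∀ x ∈ S, x * (h : G) ∈ S)
    (hN : End.of N = ∑ h : H, ρ h) (hT : End.of T = ∑ x ∈ S, ρ x) : T ≫ N = N ≫ T := by
  change End.asHom (End.of N * End.of T) = End.asHom (End.of T * End.of N)
  rw [norm_mul_hecke_eq_card_nsmul ρ hl hN hT, hecke_mul_norm_eq_card_nsmul ρ hr hN hT]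

/-- `T_S ≫ N_H = |H| • T_S` as morphisms. [cite: DokchitserEtAl2022, §3 Lemma 3.6 (1) and Lemma 3.7] -/
theorem hecke_comp_norm_eq_card_nsmul (hl : ∀ h : H, ∀ x ∈ S, (h : G) * x ∈ S) (hN : End.of N = ∑ h : H, ρ h)
    (hT : End.of T = ∑ x ∈ S, ρ x) : T ≫ N = Fintype.card H • T := by
  change End.asHom (End.of N * End.of T) = _
  rw [norm_mul_hecke_eq_card_nsmul ρ hl hN hT]
  rfl

end Stable

/-! ## §2 `Tr(T_ℓ(T_S|_{B_H}) | T_ℓ B_H) = Σ_{x ∈ S} χ_ℓ(x)` -/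

section Trace

variable {K : Type u} [Field K] (ℓ : ℕ) [Fact ℓ.Prime] {X : AbelianVariety K} {G : Type} [Group G] (ρ : G →* End X)
  {H : Subgroup G} [Fintype H] {S : Finset G} {N T : X ⟶ X}

/-- **The trace of a Hecke operator on the Kani–Rosen factor is the sum of the `ℓ`-adic character over the double coset:
`Tr(T_ℓ(T_S|_{B_H}) | T_ℓ B_H) = Σ_{x ∈ S} Tr(T_ℓ ρ(x) | T_ℓ X)`** for an `H`-bi-stable finite `S ⊆ G`, `T_S = Σ_{x ∈ S} ρ(x)`,
`B_H = Im N_H`, `ℓ` invertible in `K`, ANY field (`|H| Tr(T_ℓ(T_S|)) = Tr(T_ℓ(T_S ≫ N_H)) = Tr(T_ℓ(|H| T_S)) = |H| Σ_x χ_ℓ(x)`;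
on `V_ℓ(X)^H ≅ V_ℓ(B_H)` the restriction `T_S|` is `|H|` times the double-coset operator, `Tr([HgH] | V^H) = |H|⁻¹ Σ_{x ∈ HgH} χ_V(x)`).
[cite: DokchitserEtAl2022, §3 (additive functor lemma, `F = V_ℓ`) and Lemma 3.7] [cite: Milne1986AbelianVarieties, §12 Prop. 12.9]
[cite: MumfordAV1970, §19 Thm. 1 (p. 173) and Thm. 4 (p. 180)] -/
theorem trace_tateModuleMap_imageRestrict_hecke_eq_sum (hl : ∀ h : H, ∀ x ∈ S, (h : G) * x ∈ S)
    (hr : ∀ h : H, ∀ x ∈ S, x * (h : G) ∈ S) (hN : End.of N = ∑ h : H, ρ h) (hT : End.of T = ∑ x ∈ S, ρ x)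
    (hℓ : (ℓ : K) ≠ 0) :
    LinearMap.trace ℤ_[ℓ] ((image N).tateModule ℓ)
        (tateModuleMap ℓ (imageRestrict N T T (hecke_comp_norm_eq_norm_comp_hecke ρ hl hr hN hT))) =
      ∑ x ∈ S, LinearMap.trace ℤ_[ℓ] (X.tateModule ℓ) (tateModuleMap ℓ (End.asHom (ρ x))) := by
  have hT' : T = ∑ x ∈ S, End.asHom (ρ x) := hT
  have key := trace_tateModuleMap_comp_eq_mul_trace_imageRestrict_of_ne_zero ℓ (norm_comp_norm_eq_card_nsmul ρ hN) T
    (hecke_comp_norm_eq_norm_comp_hecke ρ hl hr hN hT) hℓ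
  rw [hecke_comp_norm_eq_card_nsmul ρ hl hN hT, ← natCast_zsmul, tateModuleMap_zsmul, map_zsmul, zsmul_eq_mul,
    Int.cast_natCast] at key
  have hc : (Fintype.card H : ℤ_[ℓ]) ≠ 0 := Nat.cast_ne_zero.2 Fintype.card_ne_zero
  rw [← mul_left_cancel₀ hc key, hT', tateModuleMap_sum, map_sum]

end Trace

/-! ## §3 Finite fields: `Tr(T_ℓ(T_S|_{B_H}) ∘ T_ℓ(π_{B_H})^m) = Σ_{x ∈ S} τ_m(x)` -/

section Frobenius

variable {K : Type u} [Field K] [Finite K] (ℓ : ℕ) [Fact ℓ.Prime] {X : AbelianVariety K} {G : Type} [Group G]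
  (ρ : G →* End X) {H : Subgroup G} [Fintype H] {S : Finset G} {N T : X ⟶ X}

/-- Restriction to `B_H = Im N` is multiplicative against powers of the Frobenius: `(π_X^m ≫ T)|_{B_H} = π_{B_H}^m ≫ T|_{B_H}` for
`T` commuting with `N` (finite field). [cite: MumfordAV1970, §19 Thm. 1 (p. 173)] [cite: Milne1986AbelianVarieties, §19, proof of Thm. 19.1 (p. 144)] -/
theorem imageRestrict_frobeniusHom_pow_comp (hTN : T ≫ N = N ≫ T) (m : ℕ) :
    imageRestrict N (((End.of (frobeniusHom X) ^ m : End X) : X ⟶ X) ≫ T) (((End.of (frobeniusHom X) ^ m : End X) : X ⟶ X) ≫ T)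
        (by rw [Category.assoc, hTN, ← Category.assoc, frobeniusHom_pow_comp N m, Category.assoc]) =
      ((End.of (frobeniusHom (image N)) ^ m : End (image N)) : image N ⟶ image N) ≫ imageRestrict N T T hTN := by
  rw [imageRestrict_comp N _ T _ T (frobeniusHom_pow_comp N m) hTN, imageRestrict_frobeniusHom_pow]

/-- **Hecke operators against powers of the Frobenius on `B_H`:
`Tr(T_ℓ(T_S|_{B_H}) ∘ T_ℓ(π_{B_H})^m | T_ℓ B_H) = Σ_{x ∈ S} Tr(T_ℓ ρ(x) ∘ T_ℓ(π_X)^m | T_ℓ X)`** for an `H`-bi-stable finite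
`S ⊆ G` over a finite field with `ℓ ∤ q`, every `m ∈ ℕ` — the Eichler–Shimura-type shape "trace of (Hecke operator ×
Frobenius power) on the `H`-quotient's `ℓ`-adic `H¹` = sum over the double coset of twisted Frobenius traces of `X`"
(`|H| Tr(T_ℓ((π^m T_S)|)) = Tr(T_ℓ(π^m ≫ T_S ≫ N_H)) = |H| Tr(T_ℓ(π^m ≫ T_S))`; `m = 0` is §2).
[cite: DokchitserEtAl2022, §3 (additive functor lemma, `F = V_ℓ`), Lemma 3.7 and proof of Thm. 8.4] [cite: Milne1986AbelianVarieties, §19, proof of Thm. 19.1 (pp. 144–145)]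
[cite: MumfordAV1970, §19 Thm. 4 (p. 180)] -/
theorem trace_tateModuleMap_imageRestrict_hecke_comp_frobeniusHom_pow_eq_sum (hl : ∀ h : H, ∀ x ∈ S, (h : G) * x ∈ S)
    (hr : ∀ h : H, ∀ x ∈ S, x * (h : G) ∈ S) (hN : End.of N = ∑ h : H, ρ h) (hT : End.of T = ∑ x ∈ S, ρ x)
    (hℓ : (ℓ : K) ≠ 0) (m : ℕ) :
    LinearMap.trace ℤ_[ℓ] ((image N).tateModule ℓ)
        (tateModuleMap ℓ (imageRestrict N T T (hecke_comp_norm_eq_norm_comp_hecke ρ hl hr hN hT)) ∘ₗ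
          tateModuleMap ℓ (frobeniusHom (image N)) ^ m) =
      ∑ x ∈ S, LinearMap.trace ℤ_[ℓ] (X.tateModule ℓ)
        (tateModuleMap ℓ (End.asHom (ρ x)) ∘ₗ tateModuleMap ℓ (frobeniusHom X) ^ m) := by
  have hTN := hecke_comp_norm_eq_norm_comp_hecke ρ hl hr hN hT
  have hT' : T = ∑ x ∈ S, End.asHom (ρ x) := hT
  -- `b = π^m ≫ T_S` commutes with `N_H` and `b ≫ N_H = |H| • b`
  have hb : (((End.of (frobeniusHom X) ^ m : End X) : X ⟶ X) ≫ T) ≫ N =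
      N ≫ (((End.of (frobeniusHom X) ^ m : End X) : X ⟶ X) ≫ T) := by
    rw [Category.assoc, hTN, ← Category.assoc, frobeniusHom_pow_comp N m, Category.assoc]
  have key := trace_tateModuleMap_comp_eq_mul_trace_imageRestrict_of_ne_zero ℓ (norm_comp_norm_eq_card_nsmul ρ hN) _ hb hℓ
  rw [Category.assoc, hecke_comp_norm_eq_card_nsmul ρ hl hN hT, Preadditive.comp_nsmul, ← natCast_zsmul, tateModuleMap_zsmul,
    map_zsmul, zsmul_eq_mul, Int.cast_natCast] at key
  have hc : (Fintype.card H : ℤ_[ℓ]) ≠ 0 := Nat.cast_ne_zero.2 Fintype.card_ne_zero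
  have key' := mul_left_cancel₀ hc key
  -- left side: `T_ℓ(T|) ∘ T_ℓ(π_B)^m = T_ℓ((π^m ≫ T)|)`
  rw [← tateModuleMap_end_pow, ← tateModuleMap_comp, ← imageRestrict_frobeniusHom_pow_comp hTN m, ← key', hT',
    Preadditive.comp_sum, tateModuleMap_sum, map_sum]
  refine Finset.sum_congr rfl fun x _ ↦ ?_
  rw [tateModuleMap_comp, tateModuleMap_end_pow]

end Frobenius

end AbelianVariety

end Literature.AlgebraicGeometry.Motives
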